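import Summits.CriticalPhenomena.Ising3D.TaylorRegionDeltaLitOddP
import Mathlib.Tactic.Linarith
import Mathlib.Tactic.Positivity
import Mathlib.Tactic.Ring
import HarnessLib

/-!
# δ-expanded TAIL tables: the `(E, θ)` tail machinery fed from the δ-tables instead of the box enclosures
(cell `pub-ising3x`, seat recog-1 gen 14; gate (g2) — the box-width lever for the tails)

HONEST FRAMING: lottery ticket; floor = tightest certified 3D Ising CFT bounds; no exact-solution claim without a
proof. Island framing: certified exclusion region at stated derivative order and assumptions; not a determination of
the 3D Ising critical exponents beyond that.

MEASURED (recog-1 gen 14, M-g2 functional, Λ = 11): the landed literal `(P, D)` tail tables are the BOX ENCLOSURES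
`kernelPDLI … (signedChooseI (enclQ box)) ccT` (`pdLitOK`), whose twelve binomials `σ_i(s)` are enclosed
independently over the box; near `θ → 1` all `R = 49` powers of `θ` of the `(E, θ)` tables contribute with
cancellation and the independent widths add up — the `P`-coefficients of `X̂` at `θ ≈ 0.975` carry 46 %, 38 %, 31 %,
… relative width at box half-width `5·10⁻⁴` even for a θ-cell of width `10⁻⁶`, and the discriminant tail cells fail
for `θ ≥ 0.875` although pointwise `4XY − Z² ≥ 0.14·4XY` by design. REPAIR (this file): feed the SAME landed moment
substitution (`momRowLitOK`) and the SAME landed tail cells from the δ-COMBINED table `T₀ + [−W, W]·T₁ + [0, W²]·T₂`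
built at the tail shift `cc = ccT` (`deltaTfull`, landed, TaylorRegionDeltaRows) — shipped as three literal δ-tables
per component (`tabOKcT`, one containment per (component, order)) and combined in the kernel (`fullT`, linear).
Prototype reach (exact twin): all 128 D-cells pass at half-width `5·10⁻⁴` with `dP = 4` and at `2·10⁻³` with `dP =
6` (box tables: 18 resp. 50 of 128 fail). Soundness: the value identity `qSum(s₀ + δ) = eval2 (substMom (deltaQfull
δ)) (E − ccT) (j/E)` (`qSum_eq_eval2_substMom_delta`, from the landed `evenKernel_eq_eval2_delta` /
`qSum_eq_evalR_qRowOfTable_of_eval2` / `eval2_substMom`) and `PMem2 (deltaQfull δ) (fullT …)` (`pmem2_fullT`). The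
assembly theorems are `taylorEvenRegion_of_splitΔLPT` / `oddCone_of_splitΔLPT` (TaylorRegionDeltaTailsEven / …Odd).
Elementary. [folklore]
-/

namespace Summit.CriticalPhenomena.Ising3D

open Finset Set
open Literature.Analysis.ValidatedNumerics Literature.Analysis.ValidatedNumerics.PolyMP
open Literature.Analysis.ValidatedNumerics.NumericsMP (MI)
open Literature.MathematicalPhysics.QuantumFieldTheory.ConformalBootstrap3D

/-! ### The value identity through the substituted δ-combined table -/

/-- Row `j` of a `(P, D)` table evaluated at `P = E − cc` is the moment-substituted `(E, θ)` table evaluated at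
`(E − cc, j/E)`. [folklore] -/
theorem evalR_qRowOfTable_eq_eval2_substMom (Q : List (List ℝ)) (cc : ℝ) {N R : ℕ} (hR : momLenOK N R = true)
    {E : ℝ} (hE : 0 < E) (j : ℕ) :
    evalR (qRowOfTable Q N j) (E - cc) = eval2 (substMom Q cc N R) (E - cc) ((j : ℝ) / E) := by
  rw [evalR_qRowOfTable, eval2_substMom]
  refine Finset.sum_congr rfl fun k hk => ?_
  rw [show E - cc + cc = E by ring, div_mul_cancel₀ _ hE.ne',
    hMoment_eq_sum_momCoeff (momLen_of_ok hR (Finset.mem_range.mp hk)) j]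

/-- **The q-sum over a wide box through the substituted δ-combined table** (`s = s₀ + δ`, `|δ| ≤ W`):
`q̂(E, j; s) = eval2 (substMom (deltaQfull … δ) cc N R) (E − cc) (j/E)`. [folklore] -/
theorem qSum_eq_eval2_substMom_delta {S : ℕ} (hS : 0 < S) (cQ : ℕ × ℕ → ℚ) (σQ : ℚ) (s₀ : ℚ) {W : ℚ} (hW : 0 ≤ W)
    (cc : ℚ) {l : List (ℕ × ℕ)} (hl : l.Nodup) {N R : ℕ} (hN : deltaSizeOK S cQ σQ s₀ W cc l N = true)
    (hR : momLenOK N R = true) {δ : ℝ} (hδ : |δ| ≤ W) {E : ℝ} (hE : 0 < E) (j : ℕ) :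
    qSum (fun ab => (cQ ab : ℝ)) l.toFinset ((s₀ : ℝ) + δ) (σQ : ℝ) E j =
      eval2 (substMom (deltaQfull cQ σQ s₀ cc l δ) (cc : ℝ) N R) (E - cc) ((j : ℝ) / E) := by
  have hsize : size2 (deltaQfull cQ σQ s₀ cc l δ) ≤ N := by
    rw [size2_eq_of_pmem2 (pmem2_deltaQfull hS cQ σQ s₀ hW cc l hδ)]
    exact of_decide_eq_true hN
  have hQ : ∀ u v : ℝ, eval2 (deltaQfull cQ σQ s₀ cc l δ) (u + v - cc) (u - v) =
      evenKernel (fun ab => (cQ ab : ℝ)) l.toFinset ((s₀ : ℝ) + δ) (σQ : ℝ) u v := fun u v => by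
    rw [evenKernel_eq_eval2_delta cQ σQ s₀ cc hl δ u v, deltaQfull, eval2_add2, eval2_add2, eval2_smul2, eval2_smul2]
    ring
  rw [qSum_eq_evalR_qRowOfTable_of_eval2 _ _ _ _ _ _ hQ hsize E j, evalR_qRowOfTable_eq_eval2_substMom _ _ hR hE]

/-! ### The δ-combined table from three LITERAL δ-tables -/

/-- `T₀ + [−W, W]·T₁ + [0, W²]·T₂` from a literal δ-table triple (the kernel forms it; linear). [folklore] -/
def fullT (S : ℕ) (W : ℚ) (T : ITab3) : IPoly2 :=
  add2I T.1 (add2I (smul2MI S (enclQ S (-W) W) T.2.1) (smul2MI S (enclQ S 0 (W ^ 2)) T.2.2))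

/-- **The δ-combined literal table encloses the real kernel table at every `s₀ + δ`, `|δ| ≤ W`.** [folklore] -/
theorem pmem2_fullT {S : ℕ} (hS : 0 < S) (c : ℕ × ℕ → ℚ) (σQ s₀ : ℚ) {W : ℚ} (hW : 0 ≤ W) (cc : ℚ) (l : List (ℕ × ℕ))
    {T : ITab3} (hT : ∀ m : ℕ, m < 3 → tabOK S c σQ s₀ W cc l T m = true) {δ : ℝ} (hδ : |δ| ≤ W) :
    PMem2 S (deltaQfull c σQ s₀ cc l δ) (fullT S W T) := by
  have h0 : subset2I (deltaT0 S c σQ s₀ cc l) T.1 = true := hT 0 (by norm_num)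
  have h1 : subset2I (deltaT1 S c σQ s₀ cc l) T.2.1 = true := hT 1 (by norm_num)
  have h2 : subset2I (deltaT2 S c σQ s₀ W cc l) T.2.2 = true := hT 2 (by norm_num)
  have hδI : MI.mem S δ (enclQ S (-W) W) :=
    mem_enclQ S (by push_cast; linarith [neg_abs_le δ, hδ, (abs_le.mp hδ).1]) (by linarith [le_abs_self δ])
  have hδ2 : MI.mem S (δ ^ 2) (enclQ S 0 (W ^ 2)) := by
    refine mem_enclQ S (by push_cast; positivity) ?_
    have : δ ^ 2 ≤ (W : ℝ) ^ 2 := by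
      rw [← sq_abs]; exact pow_le_pow_left₀ (abs_nonneg δ) hδ 2
    exact_mod_cast this
  exact pmem2_add2I (pmem2_of_subset2I (pmem2_deltaT0 hS c σQ s₀ cc l) h0)
    (pmem2_add2I (pmem2_smul2MI hS hδI (pmem2_of_subset2I (pmem2_deltaT1 hS c σQ s₀ cc l) h1))
      (pmem2_smul2MI hS hδ2 (pmem2_of_subset2I (pmem2_deltaT2 hS c σQ s₀ hW cc l hδ) h2)))

/-- **The substituted real table of a component lies in the literal `(E, θ)` table** when its rows contain the rows
computed from the δ-combined literal table. [folklore] -/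
theorem pmem2_substMom_delta {S : ℕ} (hS : 0 < S) (c : ℕ × ℕ → ℚ) (σQ s₀ : ℚ) {W : ℚ} (hW : 0 ≤ W) (cc : ℚ)
    (l : List (ℕ × ℕ)) {T : ITab3} (hT : ∀ m : ℕ, m < 3 → tabOK S c σQ s₀ W cc l T m = true) {δ : ℝ} (hδ : |δ| ≤ W)
    (N R : ℕ) {LT : IPoly2} (hlen : LT.length = R)
    (hrows : ∀ r : ℕ, r < R → subsetI (substMomRowI S (fullT S W T) cc N r) (LT.getD r []) = true) :
    PMem2 S (substMom (deltaQfull c σQ s₀ cc l δ) (cc : ℝ) N R) LT :=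
  pmem2_substMom_of_rows hS (pmem2_fullT hS c σQ s₀ hW cc l hT hδ) cc N R hlen hrows

/-! ### Data-level Booleans (even and odd): δ-tables at the TAIL shift, their combination, sizes -/

namespace EvenRegionDataΔ

variable (d : EvenRegionDataΔ)

/-- δ-table containment of component `c`, order `m`, at the TAIL shift `ccT` (one declaration each). [folklore] -/
def tabOKcT (TTt : ITab3 × ITab3 × ITab3 × ITab3) (c m : ℕ) : Bool :=
  tabOK d.S (d.compC c) (EvenRegionDataΔ.compσ c) (d.comps₀ c) (d.compW c) d.ccT d.l (proj4 TTt c) m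

/-- The four δ-combined `(P, D)` tail tables (formed in the kernel from the literal δ-tables). [folklore] -/
def tailLP (TTt : ITab3 × ITab3 × ITab3 × ITab3) : IPoly2 × IPoly2 × IPoly2 × IPoly2 :=
  (fullT d.S d.Wσ TTt.1, fullT d.S d.Wε TTt.2.1, fullT d.S d.Wb TTt.2.2.1, fullT d.S d.Wb TTt.2.2.2)

/-- Sizes of the δ-tables at the tail shift. [folklore] -/
def tailSizesOKΔ : Bool :=
  deltaSizeOK d.S (d.cQ 0) (-1) d.σ0 d.Wσ d.ccT d.l d.N && deltaSizeOK d.S (d.cQ 1) (-1) d.ε0 d.Wε d.ccT d.l d.N &&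
    deltaSizeOK d.S (d.cQ 3) (-1) d.b0 d.Wb d.ccT d.l d.N && deltaSizeOK d.S (d.cQ 4) 1 d.b0 d.Wb d.ccT d.l d.N

end EvenRegionDataΔ

namespace OddConeRegionDataΔ

variable (d : OddConeRegionDataΔ)

/-- δ-table containment of component `c ∈ {q̂₃, q̂₄, q̂₅, ψ̂₀, ψ̂_t}`, order `m`, at the TAIL shift `ccT`. [folklore] -/
def tabOKcT (TTt : ITab3x5) (c m : ℕ) : Bool :=
  tabOK d.S (d.compC c) (OddConeRegionDataΔ.compσ c) (d.comps₀ c) (d.compW c) d.ccT (d.compL c) (proj5 TTt c) m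

/-- The five δ-combined `(P, D)` tail tables. [folklore] -/
def tailLP (TTt : ITab3x5) : IPoly2x5 :=
  (fullT d.S d.Wb TTt.1, fullT d.S d.Wσ TTt.2.1, fullT d.S d.Wσ TTt.2.2.1, fullT d.S 0 TTt.2.2.2.1,
    fullT d.S d.Wt TTt.2.2.2.2)

/-- Sizes of the δ-tables at the tail shift. [folklore] -/
def tailSizesOKΔ : Bool :=
  deltaSizeOK d.S (d.cQ 2) (-1) d.b0 d.Wb d.ccT d.l d.N && deltaSizeOK d.S (d.cQ 3) (-1) d.σ0 d.Wσ d.ccT d.l d.N &&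
    deltaSizeOK d.S (d.cQ 4) 1 d.σ0 d.Wσ d.ccT d.l d.N && deltaSizeOK d.S d.ψQ 0 0 0 d.ccT d.lψ d.N &&
    deltaSizeOK d.S d.ψQ 0 d.t0 d.Wt d.ccT d.lψ d.N

end OddConeRegionDataΔ

end Summit.CriticalPhenomena.Ising3D
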